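import Summits.HodgeConjecture.HodgeConjecture.Cruxes.BlochSeedDiscOne.SeedCheckerFullExchangeCore
import Summits.HodgeConjecture.HodgeConjecture.Cruxes.BlochSeedDiscOne.SeedCheckerFullExchangeG1a
import Summits.HodgeConjecture.HodgeConjecture.Cruxes.BlochSeedDiscOne.SeedCheckerFullExchangeG1b
import Summits.HodgeConjecture.HodgeConjecture.Cruxes.BlochSeedDiscOne.SeedCheckerFullExchangeG1c
import Summits.HodgeConjecture.HodgeConjecture.Cruxes.BlochSeedDiscOne.SeedCheckerFullExchangeG1d
import Summits.HodgeConjecture.HodgeConjecture.Cruxes.BlochSeedDiscOne.SeedCheckerFullExchangeG1e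
import Summits.HodgeConjecture.HodgeConjecture.Cruxes.BlochSeedDiscOne.SeedCheckerFullExchangeG1f
import Summits.HodgeConjecture.HodgeConjecture.Cruxes.BlochSeedDiscOne.SeedCheckerFullExchangeG1g
import Summits.HodgeConjecture.HodgeConjecture.Cruxes.BlochSeedDiscOne.SeedCheckerFullExchangeG2a
import Summits.HodgeConjecture.HodgeConjecture.Cruxes.BlochSeedDiscOne.SeedCheckerFullExchangeG2b
import Summits.HodgeConjecture.HodgeConjecture.Cruxes.BlochSeedDiscOne.SeedCheckerFullExchangeG2c
import Summits.HodgeConjecture.HodgeConjecture.Cruxes.BlochSeedDiscOne.SeedCheckerFullExchangeG2d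
import Summits.HodgeConjecture.HodgeConjecture.Cruxes.BlochSeedDiscOne.SeedCheckerFullExchangeG2e
import Summits.HodgeConjecture.HodgeConjecture.Cruxes.BlochSeedDiscOne.SeedCheckerFullExchangeG2f
import Summits.HodgeConjecture.HodgeConjecture.Cruxes.BlochSeedDiscOne.SeedCheckerFullExchangeG2g
import Summits.HodgeConjecture.HodgeConjecture.Cruxes.BlochSeedDiscOne.SeedCheckerFullExchangeG3a
import Summits.HodgeConjecture.HodgeConjecture.Cruxes.BlochSeedDiscOne.SeedCheckerFullExchangeG3b
import Summits.HodgeConjecture.HodgeConjecture.Cruxes.BlochSeedDiscOne.SeedCheckerFullExchangeG3c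
import Summits.HodgeConjecture.HodgeConjecture.Cruxes.BlochSeedDiscOne.SeedCheckerFullExchangeG3d
import Summits.HodgeConjecture.HodgeConjecture.Cruxes.BlochSeedDiscOne.SeedCheckerFullExchangeG3e
import Summits.HodgeConjecture.HodgeConjecture.Cruxes.BlochSeedDiscOne.SeedCheckerFullExchangeG3f
import Summits.HodgeConjecture.HodgeConjecture.Cruxes.BlochSeedDiscOne.SeedCheckerFullExchangeG3g
import Summits.HodgeConjecture.HodgeConjecture.Cruxes.BlochSeedDiscOne.SeedCheckerFullExchangeG4a
import Summits.HodgeConjecture.HodgeConjecture.Cruxes.BlochSeedDiscOne.SeedCheckerFullExchangeG4b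
import Summits.HodgeConjecture.HodgeConjecture.Cruxes.BlochSeedDiscOne.SeedCheckerFullExchangeG4c
import Summits.HodgeConjecture.HodgeConjecture.Cruxes.BlochSeedDiscOne.SeedCheckerFullExchangeG4d
import Summits.HodgeConjecture.HodgeConjecture.Cruxes.BlochSeedDiscOne.SeedCheckerFullExchangeG4e
import Summits.HodgeConjecture.HodgeConjecture.Cruxes.BlochSeedDiscOne.SeedCheckerFullExchangeG4f
import Summits.HodgeConjecture.HodgeConjecture.Cruxes.BlochSeedDiscOne.SeedCheckerFullExchangeG4g

/-!
# SeedCheckerFullExchangeLaw — the FULL-EXCHANGE TRICHOTOMY LAWS A/B/C stated once, for every cell (hsemireg-c5c8-1 g37 draft, assembled g43)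

C5–C8 seed checker, CLASS-LEVEL two-block CONTROL model (`SeedCheckerFullExchangeCore`): a cell is `(nb, nt, g)` with
bottom block `Gb : [0,nb] → ℤ`, top block `Gt : [0,nt] → ℤ` at `t0 = nb + 1257 + g`, tower length `T = nb + nt + g + 1259`;
`IsPairFull` = caps + the eight global moment rows (rows may EXCHANGE between the blocks), `IsPair` = g36's row-6 family
(rows 0–5 vanish per block), `LowZero nb nt m` = rows `0 … m−1` vanish per block, `CellDeadFull` = no full-exchange pair.

The 28 part files `SeedCheckerFullExchangeG<g><x>` (gap `g ∈ {1,2,3,4}`, consecutive `nb`-windows `x ∈ {a,…,g}`) each prove,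
from kernel-checked (`decide`) exact LP + integrality certificates, the three laws on their window:
`low5`, `full_iff_row6_le1303`, `dead_le1301`. The parts import Mathlib only and carry their own copies `G<g><x>.IsPairFull …`
of the Core predicates (textually identical definitions, so definitionally equal by unfolding); this file only DISPATCHES on
`g` (`interval_cases`) and on the `nb`-window (an `if`-chain whose cut-points are the parts' windows) and states each law
UNRESTRICTED over the Core predicates:

* `low5_all` — LAW A: rows 0–4 never exchange: `IsPairFull nb nt g Gb Gt → LowZero nb nt 5 Gb Gt` for `1 ≤ g ≤ 4`, `nb + nt + g ≤ 50` (T ≤ 1309);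
* `full_iff_row6_le1303_all` — LAW B: for `nb + nt + g ≤ 44` (T ≤ 1303) `IsPairFull ↔ IsPair` (no row-5 exchange below 1304:
  there the full family IS g36's row-6 family, so every g36 law holds verbatim for full exchange);
* `dead_le1301_all` — LAW C (LAW 1301 for the full family): `nb + nt + g ≤ 42` (T ≤ 1301) ⇒ `CellDeadFull nb nt g`.

Gaps `g ≥ 5`: the g37 memo (§1) records that their cap pattern equals that of `g = 4` — a memo-level remark, NOT a theorem of this file
(the laws below are stated for `1 ≤ g ≤ 4` only); `g = 0` is not a two-block cell.
LAW D/E (corner-5 box of the 115 open cells, reduced-cell charge windows) stay per part (`corner5`, `red_window`, `open_<nb>_<nt>`),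
because their hypotheses are the parts' literal `openCells` / `redWindows` tables.

Honest framing: nothing here is proved toward HC ∕ HC_CM ∕ HC_AV ∕ ladder rung №4 ∕ stmt-26512 ∕ stmt-18881 ∕ H2. This is a
necessary-condition census of a CONTROL search space (which integer class vectors a two-block seed tower could have) — not a design,
not a seed, not a rung; it does not import the route, and the stub `stub_rung_pad4_seedAt` is neither restated nor weakened.
Memo of record: HOME `hsemireg-c5c8-1/SEED-CHECKER-C5C8-c5c8-1-g37.md` (§3 the trichotomy law, §6 the part files).
-/

set_option maxRecDepth 100000

namespace Summit.HodgeConjecture.HodgeConjecture.Cruxes.BlochSeedDiscOne.SeedChecker.FullExchange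

/-- LAW A: rows 0–4 never exchange (every cell, 1 ≤ g ≤ 4, T ≤ 1309). -/
theorem low5_all (nb nt g : ℕ) (hg1 : 1 ≤ g) (hg4 : g ≤ 4) (h : nb + nt + g ≤ 50) :
    ∀ Gb Gt : ℕ → ℤ, IsPairFull nb nt g Gb Gt → LowZero nb nt 5 Gb Gt := by
  interval_cases g
  · -- g = 1
    if h0 : nb ≤ 6 then exact G1a.low5 nb nt ⟨by omega, h0⟩ h
    else if h1 : nb ≤ 10 then exact G1b.low5 nb nt ⟨by omega, h1⟩ h
    else if h2 : nb ≤ 14 then exact G1c.low5 nb nt ⟨by omega, h2⟩ h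
    else if h3 : nb ≤ 18 then exact G1d.low5 nb nt ⟨by omega, h3⟩ h
    else if h4 : nb ≤ 22 then exact G1e.low5 nb nt ⟨by omega, h4⟩ h
    else if h5 : nb ≤ 27 then exact G1f.low5 nb nt ⟨by omega, h5⟩ h
    else exact G1g.low5 nb nt ⟨by omega, by omega⟩ h
  · -- g = 2
    if h0 : nb ≤ 6 then exact G2a.low5 nb nt ⟨by omega, h0⟩ h
    else if h1 : nb ≤ 10 then exact G2b.low5 nb nt ⟨by omega, h1⟩ h
    else if h2 : nb ≤ 13 then exact G2c.low5 nb nt ⟨by omega, h2⟩ h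
    else if h3 : nb ≤ 16 then exact G2d.low5 nb nt ⟨by omega, h3⟩ h
    else if h4 : nb ≤ 21 then exact G2e.low5 nb nt ⟨by omega, h4⟩ h
    else if h5 : nb ≤ 26 then exact G2f.low5 nb nt ⟨by omega, h5⟩ h
    else exact G2g.low5 nb nt ⟨by omega, by omega⟩ h
  · -- g = 3
    if h0 : nb ≤ 6 then exact G3a.low5 nb nt ⟨by omega, h0⟩ h
    else if h1 : nb ≤ 10 then exact G3b.low5 nb nt ⟨by omega, h1⟩ h
    else if h2 : nb ≤ 13 then exact G3c.low5 nb nt ⟨by omega, h2⟩ h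
    else if h3 : nb ≤ 17 then exact G3d.low5 nb nt ⟨by omega, h3⟩ h
    else if h4 : nb ≤ 21 then exact G3e.low5 nb nt ⟨by omega, h4⟩ h
    else if h5 : nb ≤ 26 then exact G3f.low5 nb nt ⟨by omega, h5⟩ h
    else exact G3g.low5 nb nt ⟨by omega, by omega⟩ h
  · -- g = 4
    if h0 : nb ≤ 6 then exact G4a.low5 nb nt ⟨by omega, h0⟩ h
    else if h1 : nb ≤ 9 then exact G4b.low5 nb nt ⟨by omega, h1⟩ h
    else if h2 : nb ≤ 12 then exact G4c.low5 nb nt ⟨by omega, h2⟩ h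
    else if h3 : nb ≤ 16 then exact G4d.low5 nb nt ⟨by omega, h3⟩ h
    else if h4 : nb ≤ 20 then exact G4e.low5 nb nt ⟨by omega, h4⟩ h
    else if h5 : nb ≤ 25 then exact G4f.low5 nb nt ⟨by omega, h5⟩ h
    else exact G4g.low5 nb nt ⟨by omega, by omega⟩ h

/-- LAW B: below T = 1304 the full-exchange family is the row-6 family. -/
theorem full_iff_row6_le1303_all (nb nt g : ℕ) (hg1 : 1 ≤ g) (hg4 : g ≤ 4) (hT : nb + nt + g ≤ 44) (Gb Gt : ℕ → ℤ) :
    IsPairFull nb nt g Gb Gt ↔ IsPair nb nt g Gb Gt := by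
  interval_cases g
  · -- g = 1
    if h0 : nb ≤ 6 then exact G1a.full_iff_row6_le1303 nb nt ⟨by omega, h0⟩ hT Gb Gt
    else if h1 : nb ≤ 10 then exact G1b.full_iff_row6_le1303 nb nt ⟨by omega, h1⟩ hT Gb Gt
    else if h2 : nb ≤ 14 then exact G1c.full_iff_row6_le1303 nb nt ⟨by omega, h2⟩ hT Gb Gt
    else if h3 : nb ≤ 18 then exact G1d.full_iff_row6_le1303 nb nt ⟨by omega, h3⟩ hT Gb Gt
    else if h4 : nb ≤ 22 then exact G1e.full_iff_row6_le1303 nb nt ⟨by omega, h4⟩ hT Gb Gt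
    else if h5 : nb ≤ 27 then exact G1f.full_iff_row6_le1303 nb nt ⟨by omega, h5⟩ hT Gb Gt
    else exact G1g.full_iff_row6_le1303 nb nt ⟨by omega, by omega⟩ hT Gb Gt
  · -- g = 2
    if h0 : nb ≤ 6 then exact G2a.full_iff_row6_le1303 nb nt ⟨by omega, h0⟩ hT Gb Gt
    else if h1 : nb ≤ 10 then exact G2b.full_iff_row6_le1303 nb nt ⟨by omega, h1⟩ hT Gb Gt
    else if h2 : nb ≤ 13 then exact G2c.full_iff_row6_le1303 nb nt ⟨by omega, h2⟩ hT Gb Gt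
    else if h3 : nb ≤ 16 then exact G2d.full_iff_row6_le1303 nb nt ⟨by omega, h3⟩ hT Gb Gt
    else if h4 : nb ≤ 21 then exact G2e.full_iff_row6_le1303 nb nt ⟨by omega, h4⟩ hT Gb Gt
    else if h5 : nb ≤ 26 then exact G2f.full_iff_row6_le1303 nb nt ⟨by omega, h5⟩ hT Gb Gt
    else exact G2g.full_iff_row6_le1303 nb nt ⟨by omega, by omega⟩ hT Gb Gt
  · -- g = 3
    if h0 : nb ≤ 6 then exact G3a.full_iff_row6_le1303 nb nt ⟨by omega, h0⟩ hT Gb Gt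
    else if h1 : nb ≤ 10 then exact G3b.full_iff_row6_le1303 nb nt ⟨by omega, h1⟩ hT Gb Gt
    else if h2 : nb ≤ 13 then exact G3c.full_iff_row6_le1303 nb nt ⟨by omega, h2⟩ hT Gb Gt
    else if h3 : nb ≤ 17 then exact G3d.full_iff_row6_le1303 nb nt ⟨by omega, h3⟩ hT Gb Gt
    else if h4 : nb ≤ 21 then exact G3e.full_iff_row6_le1303 nb nt ⟨by omega, h4⟩ hT Gb Gt
    else if h5 : nb ≤ 26 then exact G3f.full_iff_row6_le1303 nb nt ⟨by omega, h5⟩ hT Gb Gt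
    else exact G3g.full_iff_row6_le1303 nb nt ⟨by omega, by omega⟩ hT Gb Gt
  · -- g = 4
    if h0 : nb ≤ 6 then exact G4a.full_iff_row6_le1303 nb nt ⟨by omega, h0⟩ hT Gb Gt
    else if h1 : nb ≤ 9 then exact G4b.full_iff_row6_le1303 nb nt ⟨by omega, h1⟩ hT Gb Gt
    else if h2 : nb ≤ 12 then exact G4c.full_iff_row6_le1303 nb nt ⟨by omega, h2⟩ hT Gb Gt
    else if h3 : nb ≤ 16 then exact G4d.full_iff_row6_le1303 nb nt ⟨by omega, h3⟩ hT Gb Gt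
    else if h4 : nb ≤ 20 then exact G4e.full_iff_row6_le1303 nb nt ⟨by omega, h4⟩ hT Gb Gt
    else if h5 : nb ≤ 25 then exact G4f.full_iff_row6_le1303 nb nt ⟨by omega, h5⟩ hT Gb Gt
    else exact G4g.full_iff_row6_le1303 nb nt ⟨by omega, by omega⟩ hT Gb Gt

/-- LAW C: LAW 1301 for the full family. -/
theorem dead_le1301_all (nb nt g : ℕ) (hg1 : 1 ≤ g) (hg4 : g ≤ 4) (hT : nb + nt + g ≤ 42) : CellDeadFull nb nt g := by
  interval_cases g
  · -- g = 1
    if h0 : nb ≤ 6 then exact G1a.dead_le1301 nb nt ⟨by omega, h0⟩ hT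
    else if h1 : nb ≤ 10 then exact G1b.dead_le1301 nb nt ⟨by omega, h1⟩ hT
    else if h2 : nb ≤ 14 then exact G1c.dead_le1301 nb nt ⟨by omega, h2⟩ hT
    else if h3 : nb ≤ 18 then exact G1d.dead_le1301 nb nt ⟨by omega, h3⟩ hT
    else if h4 : nb ≤ 22 then exact G1e.dead_le1301 nb nt ⟨by omega, h4⟩ hT
    else if h5 : nb ≤ 27 then exact G1f.dead_le1301 nb nt ⟨by omega, h5⟩ hT
    else exact G1g.dead_le1301 nb nt ⟨by omega, by omega⟩ hT
  · -- g = 2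
    if h0 : nb ≤ 6 then exact G2a.dead_le1301 nb nt ⟨by omega, h0⟩ hT
    else if h1 : nb ≤ 10 then exact G2b.dead_le1301 nb nt ⟨by omega, h1⟩ hT
    else if h2 : nb ≤ 13 then exact G2c.dead_le1301 nb nt ⟨by omega, h2⟩ hT
    else if h3 : nb ≤ 16 then exact G2d.dead_le1301 nb nt ⟨by omega, h3⟩ hT
    else if h4 : nb ≤ 21 then exact G2e.dead_le1301 nb nt ⟨by omega, h4⟩ hT
    else if h5 : nb ≤ 26 then exact G2f.dead_le1301 nb nt ⟨by omega, h5⟩ hT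
    else exact G2g.dead_le1301 nb nt ⟨by omega, by omega⟩ hT
  · -- g = 3
    if h0 : nb ≤ 6 then exact G3a.dead_le1301 nb nt ⟨by omega, h0⟩ hT
    else if h1 : nb ≤ 10 then exact G3b.dead_le1301 nb nt ⟨by omega, h1⟩ hT
    else if h2 : nb ≤ 13 then exact G3c.dead_le1301 nb nt ⟨by omega, h2⟩ hT
    else if h3 : nb ≤ 17 then exact G3d.dead_le1301 nb nt ⟨by omega, h3⟩ hT
    else if h4 : nb ≤ 21 then exact G3e.dead_le1301 nb nt ⟨by omega, h4⟩ hT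
    else if h5 : nb ≤ 26 then exact G3f.dead_le1301 nb nt ⟨by omega, h5⟩ hT
    else exact G3g.dead_le1301 nb nt ⟨by omega, by omega⟩ hT
  · -- g = 4
    if h0 : nb ≤ 6 then exact G4a.dead_le1301 nb nt ⟨by omega, h0⟩ hT
    else if h1 : nb ≤ 9 then exact G4b.dead_le1301 nb nt ⟨by omega, h1⟩ hT
    else if h2 : nb ≤ 12 then exact G4c.dead_le1301 nb nt ⟨by omega, h2⟩ hT
    else if h3 : nb ≤ 16 then exact G4d.dead_le1301 nb nt ⟨by omega, h3⟩ hT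
    else if h4 : nb ≤ 20 then exact G4e.dead_le1301 nb nt ⟨by omega, h4⟩ hT
    else if h5 : nb ≤ 25 then exact G4f.dead_le1301 nb nt ⟨by omega, h5⟩ hT
    else exact G4g.dead_le1301 nb nt ⟨by omega, by omega⟩ hT

end Summit.HodgeConjecture.HodgeConjecture.Cruxes.BlochSeedDiscOne.SeedChecker.FullExchange
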